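import Literature.Computability.Cryptography.WordRAM
import Literature.Computability.Cryptography.WordRAMExec
import Literature.Computability.Cryptography.WordRAMProofs
import HarnessLib

/-!
# The word RAM — read counting (a `t`-step oracle-free run reads at most `5t` cells)

The frame lemma behind every "an algorithm must at least read its input" (`Ω(n)`, adversary /
unread-cell) lower bound for the concrete word RAM of `Literature.Computability.Cryptography.WordRAM`,
for *oracle-free* programs (the setting of the running-time predicates `FGProblem.InTime…`; a
`query` instruction reads a whole memory segment, so no such bound holds for oracle programs):

* `Operand.exists_reads`, `Operand.exists_reads_write`: evaluating an operand reads at most two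
  cells (`imm`: none, `dir a`: cell `a`, `ind a`: cells `a` and `mem a`); the cell *written through*
  an operand is determined by at most one read (`ind a`: cell `a`);
* `exists_reads_of_step`: **one step reads at most five cells** — there is a set `S` of at most
  `5` addresses, depending only on the current configuration, such that any configuration with the
  same control state (`pc`, `coinPos`, `queries`) whose memory agrees with the current one on `S`
  steps to a configuration with the same control state, and agreement of the two memories at any
  cell is preserved by the step (`op`: two operands and the destination address, `2 + 2 + 1`;
  `jz`: one operand; `rand`: the destination address; `jmp`, `halt`: nothing);
* `exists_reads_of_run`: along `n` steps the run is determined by at most `5 n` cells of the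
  initial memory, in the same sense;
* `OutputsWithin.exists_reads`: **the output of a run of at most `t` steps is determined by at
  most `5 t` input cells** — changing the input at positions whose cells are not among them (and
  which lie beyond the output segment) changes neither the halting time nor the output.

Companion of `…WordRAMWrites` (a `t`-step run writes at most `t` cells), same proof pattern (case
analysis of `step`, induction along `run = (flip bind step)^[n]`). The adversary argument built on
it ("a correct algorithm for a problem whose answer depends on every input position takes `Ω(n)`
steps") is the standard unconditional linear lower bound, e.g. for `k`-SUM and 3SUM
(`Literature.Computability.FineGrained.ConjecturesThreeSUMDetProofs`).

## References

* T. Hagerup, *Sorting and searching on the word RAM*, STACS 1998, §2 (one instruction accesses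
  `O(1)` words).
* Input-reading (`Ω(n)`, adversary) time lower bounds: folklore.
-/

namespace Literature.Computability.Cryptography.WordRAM

open StateTransition

/-! ## Operands -/

/-- **An operand reads at most two cells**: there is a set `S` of at most two addresses (depending
on the operand and the memory) such that the operand reads the same value in any memory agreeing
with the given one on `S` (`imm c`: `∅`; `dir a`: `{a}`; `ind a`: `{a, mem a}`). [folklore] -/
theorem Operand.exists_reads (o : Operand) (mem₁ : ℕ → ℕ) :
    ∃ S : Finset ℕ, S.card ≤ 2 ∧ ∀ mem₂ : ℕ → ℕ, (∀ a ∈ S, mem₂ a = mem₁ a) →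
      o.read mem₂ = o.read mem₁ := by
  cases o with
  | imm c => exact ⟨∅, by simp, fun mem₂ _ => rfl⟩
  | dir a => exact ⟨{a}, by simp, fun mem₂ h => h a (Finset.mem_singleton_self a)⟩
  | ind a =>
    refine ⟨{a, mem₁ a}, Finset.card_le_two, fun mem₂ h => ?_⟩
    show mem₂ (mem₂ a) = mem₁ (mem₁ a)
    rw [h a (by simp), h (mem₁ a) (by simp)]

/-- **Writing through an operand is determined by at most one read**: there is a set `S` of at most
one address (`ind a`: `{a}`, the cell holding the target address; otherwise `∅`) such that, for any
memory agreeing with the given one on `S`, writing the same value through the operand preserves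
agreement of the two memories at every cell. [folklore] -/
theorem Operand.exists_reads_write (o : Operand) (mem₁ : ℕ → ℕ) :
    ∃ S : Finset ℕ, S.card ≤ 1 ∧ ∀ mem₂ : ℕ → ℕ, (∀ a ∈ S, mem₂ a = mem₁ a) →
      ∀ (v b : ℕ), mem₂ b = mem₁ b → o.write mem₂ v b = o.write mem₁ v b := by
  cases o with
  | imm c => exact ⟨∅, by simp, fun mem₂ _ v b hb => by simpa using hb⟩
  | dir a =>
    refine ⟨∅, by simp, fun mem₂ _ v b hb => ?_⟩
    show Function.update mem₂ a v b = Function.update mem₁ a v b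
    rcases eq_or_ne b a with rfl | hba
    · simp
    · rw [Function.update_of_ne hba, Function.update_of_ne hba, hb]
  | ind a =>
    refine ⟨{a}, by simp, fun mem₂ h v b hb => ?_⟩
    show Function.update mem₂ (mem₂ a) v b = Function.update mem₁ (mem₁ a) v b
    rw [h a (Finset.mem_singleton_self a)]
    rcases eq_or_ne b (mem₁ a) with rfl | hba
    · simp
    · rw [Function.update_of_ne hba, Function.update_of_ne hba, hb]

/-! ## One step -/

/-- **One step of an oracle-free program reads at most five cells.** For every configuration `c₁`
there is a set `S` of at most `5` addresses such that every configuration `c₂` with the same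
program counter, coin position and query log whose memory agrees with `c₁.mem` on `S` behaves
alike for one step: if `c₁` steps to `d₁` then `c₂` steps to some `d₂` with the same program
counter, coin position and query log, and every cell at which the memories of `c₁`, `c₂` agree
is a cell at which the memories of `d₁`, `d₂` agree. (`op o dst x y` reads the at most `2 + 2`
cells of `x`, `y` and the address cell of `dst`; `jz x t` the cells of `x`; `rand dst` the address
cell of `dst`; a `query` would read a whole segment, whence the hypothesis `P.IsOracleFree`.)
[folklore] -/
theorem exists_reads_of_step {P : Program} (hP : P.IsOracleFree) (w : ℕ) (O : List ℕ → List ℕ)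
    (ρ : ℕ → ℕ) (c₁ : Cfg) :
    ∃ S : Finset ℕ, S.card ≤ 5 ∧ ∀ c₂ : Cfg, c₂.pc = c₁.pc → c₂.coinPos = c₁.coinPos →
      c₂.queries = c₁.queries → (∀ a ∈ S, c₂.mem a = c₁.mem a) →
      ∀ d₁ : Cfg, step P w O ρ c₁ = some d₁ → ∃ d₂ : Cfg, step P w O ρ c₂ = some d₂ ∧
        d₂.pc = d₁.pc ∧ d₂.coinPos = d₁.coinPos ∧ d₂.queries = d₁.queries ∧
        ∀ b, c₂.mem b = c₁.mem b → d₂.mem b = d₁.mem b := by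
  cases hpc : c₁.pc with
  | none =>
    refine ⟨∅, by simp, fun c₂ _ _ _ _ d₁ hd₁ => ?_⟩
    rw [step_of_pc_eq_none hpc] at hd₁
    exact absurd hd₁ (by simp)
  | some i =>
    cases hI : P[i]? with
    | none =>
      refine ⟨∅, by simp, fun c₂ h1 h2 h3 _ d₁ hd₁ => ?_⟩
      rw [step_of_getElem?_eq_none hpc hI, Option.some.injEq] at hd₁
      subst hd₁
      exact ⟨_, step_of_getElem?_eq_none h1 hI, rfl, h2, h3, fun b hb => hb⟩
    | some I =>
      cases I with
      | halt =>
        refine ⟨∅, by simp, fun c₂ h1 h2 h3 _ d₁ hd₁ => ?_⟩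
        rw [step_halt hpc hI, Option.some.injEq] at hd₁
        subst hd₁
        exact ⟨_, step_halt h1 hI, rfl, h2, h3, fun b hb => hb⟩
      | jmp t =>
        refine ⟨∅, by simp, fun c₂ h1 h2 h3 _ d₁ hd₁ => ?_⟩
        rw [step_jmp hpc hI, Option.some.injEq] at hd₁
        subst hd₁
        exact ⟨_, step_jmp h1 hI, rfl, h2, h3, fun b hb => hb⟩
      | jz x t =>
        obtain ⟨S, hS, hx⟩ := x.exists_reads c₁.mem
        refine ⟨S, by omega, fun c₂ h1 h2 h3 hmem d₁ hd₁ => ?_⟩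
        rw [step_jz hpc hI, Option.some.injEq] at hd₁
        subst hd₁
        refine ⟨_, step_jz h1 hI, ?_, h2, h3, fun b hb => hb⟩
        show (if x.read c₂.mem = 0 then some t else some (i + 1)) =
          if x.read c₁.mem = 0 then some t else some (i + 1)
        rw [hx c₂.mem hmem]
      | op o dst x y =>
        obtain ⟨Sx, hSx, hx⟩ := x.exists_reads c₁.mem
        obtain ⟨Sy, hSy, hy⟩ := y.exists_reads c₁.mem
        obtain ⟨Sd, hSd, hd⟩ := dst.exists_reads_write c₁.mem
        refine ⟨Sx ∪ Sy ∪ Sd, ?_, fun c₂ h1 h2 h3 hmem d₁ hd₁ => ?_⟩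
        · calc (Sx ∪ Sy ∪ Sd).card ≤ (Sx ∪ Sy).card + Sd.card := Finset.card_union_le _ _
            _ ≤ (Sx.card + Sy.card) + Sd.card := by gcongr; exact Finset.card_union_le _ _
            _ ≤ (2 + 2) + 1 := by omega
        rw [step_op hpc hI, Option.some.injEq] at hd₁
        subst hd₁
        refine ⟨_, step_op h1 hI, rfl, h2, h3, fun b hb => ?_⟩
        have hxr : x.read c₂.mem = x.read c₁.mem :=
          hx c₂.mem fun a ha => hmem a (by simp [ha])
        have hyr : y.read c₂.mem = y.read c₁.mem :=
          hy c₂.mem fun a ha => hmem a (by simp [ha])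
        show dst.write c₂.mem (o.eval w (x.read c₂.mem) (y.read c₂.mem)) b =
          dst.write c₁.mem (o.eval w (x.read c₁.mem) (y.read c₁.mem)) b
        rw [hxr, hyr]
        exact hd c₂.mem (fun a ha => hmem a (by simp [ha])) _ b hb
      | rand dst =>
        obtain ⟨Sd, hSd, hd⟩ := dst.exists_reads_write c₁.mem
        refine ⟨Sd, by omega, fun c₂ h1 h2 h3 hmem d₁ hd₁ => ?_⟩
        rw [step_rand hpc hI, Option.some.injEq] at hd₁
        subst hd₁
        refine ⟨_, step_rand h1 hI, rfl, by simp [h2], h3, fun b hb => ?_⟩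
        show dst.write c₂.mem (ρ c₂.coinPos % 2 ^ w) b = dst.write c₁.mem (ρ c₁.coinPos % 2 ^ w) b
        rw [h2]
        exact hd c₂.mem hmem _ b hb
      | query qa ql aa =>
        exact absurd (hP _ (List.mem_of_getElem? hI)) (by simp [Instr.isQuery])

/-! ## Whole runs -/

/-- **`n` steps read at most `5 n` cells.** If an oracle-free program reaches `c₁'` from `c₁` in
exactly `n` steps, there is a set `R` of at most `5 n` addresses such that from every configuration
`c₂` with the same control state whose memory agrees with `c₁.mem` on `R`, the program reaches in
exactly `n` steps a configuration `c₂'` with the control state of `c₁'`, the memories of `c₁'`,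
`c₂'` agreeing at every cell at which those of `c₁`, `c₂` agree. [folklore] -/
theorem exists_reads_of_run {P : Program} (hP : P.IsOracleFree) (w : ℕ) (O : List ℕ → List ℕ)
    (ρ : ℕ → ℕ) :
    ∀ (n : ℕ) (c₁ c₁' : Cfg), run P w O ρ n c₁ = some c₁' →
      ∃ R : Finset ℕ, R.card ≤ 5 * n ∧ ∀ c₂ : Cfg, c₂.pc = c₁.pc → c₂.coinPos = c₁.coinPos →
        c₂.queries = c₁.queries → (∀ a ∈ R, c₂.mem a = c₁.mem a) →
        ∃ c₂' : Cfg, run P w O ρ n c₂ = some c₂' ∧ c₂'.pc = c₁'.pc ∧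
          c₂'.coinPos = c₁'.coinPos ∧ c₂'.queries = c₁'.queries ∧
          ∀ b, c₂.mem b = c₁.mem b → c₂'.mem b = c₁'.mem b
  | 0, c₁, c₁', h => by
      simp only [run_zero, Option.some.injEq] at h
      subst h
      exact ⟨∅, by simp, fun c₂ h1 h2 h3 _ => ⟨c₂, run_zero _ _ _ _ _, h1, h2, h3, fun b hb => hb⟩⟩
  | n + 1, c₁, c₁', h => by
      cases hs : step P w O ρ c₁ with
      | none =>
        rw [run_succ_of_step_eq_none P w O ρ hs] at h
        exact absurd h (by simp)
      | some d₁ =>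
        rw [run_succ_of_step P w O ρ hs] at h
        obtain ⟨S, hS, hstep⟩ := exists_reads_of_step hP w O ρ c₁
        obtain ⟨R, hR, hrun⟩ := exists_reads_of_run hP w O ρ n d₁ c₁' h
        refine ⟨S ∪ R, (Finset.card_union_le _ _).trans (by omega), fun c₂ h1 h2 h3 hmem => ?_⟩
        obtain ⟨d₂, hd₂, hpc, hcoin, hq, hagree⟩ := hstep c₂ h1 h2 h3
          (fun a ha => hmem a (Finset.mem_union_left R ha)) d₁ hs
        obtain ⟨c₂', hc₂', hpc', hcoin', hq', hagree'⟩ := hrun d₂ hpc hcoin hq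
          (fun a ha => hagree a (hmem a (Finset.mem_union_right S ha)))
        refine ⟨c₂', ?_, hpc', hcoin', hq', fun b hb => hagree' b (hagree b hb)⟩
        rw [run_succ_of_step P w O ρ hd₂]
        exact hc₂'

/-! ## Inputs: the output is determined by the cells read -/

/-- Initial memories of two inputs of the same length agree at every cell not holding an input
word in which they differ (cell `0` holds the common length, cell `i + 1` the word `i`, the other
cells `0`). [folklore] -/
theorem init_mem_congr (w : ℕ) {x x₂ : List ℕ} (hlen : x₂.length = x.length) {a : ℕ}
    (ha : ∀ i, a = i + 1 → x₂[i]? = x[i]?) : (init w x₂).mem a = (init w x).mem a := by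
  cases a with
  | zero => rw [init_mem_zero, init_mem_zero, hlen]
  | succ i =>
    rcases lt_or_ge i x.length with hi | hi
    · have hi₂ : i < x₂.length := hlen ▸ hi
      have h := ha i rfl
      rw [List.getElem?_eq_getElem hi₂, List.getElem?_eq_getElem hi, Option.some.injEq] at h
      rw [init_mem_succ w x i hi, init_mem_succ w x₂ i hi₂, h]
    · rw [init_mem_of_length_lt w x _ (Nat.lt_succ_of_le hi),
        init_mem_of_length_lt w x₂ _ (Nat.lt_succ_of_le (hlen ▸ hi))]

/-- **The output of a `t`-step oracle-free run is determined by at most `5 t` input cells** (the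
unread-cell / adversary lemma). If `P` outputs `out` on input `x` within `t` steps, there is a set
`R` of at most `5 t` addresses such that `P` also outputs `out` within `t` steps on every input `x₂`
of the same length that differs from `x` only in words `i` whose cell `i + 1` is not in `R` and
which lie beyond the output segment (`|out| ≤ i`; the output is read from cells `1, …, |out|`).
Same word size, oracle and coins on both sides. [folklore] -/
theorem OutputsWithin.exists_reads {P : Program} (hP : P.IsOracleFree) {w : ℕ}
    {O : List ℕ → List ℕ} {ρ : ℕ → ℕ} {x out : List ℕ} {t : ℕ}
    (h : OutputsWithin P w O ρ x out t) :
    ∃ R : Finset ℕ, R.card ≤ 5 * t ∧ ∀ x₂ : List ℕ, x₂.length = x.length →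
      (∀ i, x₂[i]? ≠ x[i]? → i + 1 ∉ R ∧ out.length ≤ i) → OutputsWithin P w O ρ x₂ out t := by
  obtain ⟨c₁, ⟨e⟩, hc₁, hout⟩ := h
  have hrun₁ : run P w O ρ e.steps (init w x) = some c₁ := e.evals_in_steps
  obtain ⟨R, hR, hrun⟩ := exists_reads_of_run hP w O ρ e.steps _ _ hrun₁
  refine ⟨R, hR.trans (Nat.mul_le_mul_left 5 e.steps_le_m), fun x₂ hlen hdiff => ?_⟩
  have hagree : ∀ a, (∀ i, a = i + 1 → x₂[i]? ≠ x[i]? → False) →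
      (init w x₂).mem a = (init w x).mem a := fun a ha =>
    init_mem_congr w hlen fun i hi => by_contra fun hne => ha i hi hne
  obtain ⟨c₂, hc₂, hpc, -, -, hmem⟩ := hrun (init w x₂) rfl rfl rfl fun a haR =>
    hagree a fun i hi hne => (hdiff i hne).1 (hi ▸ haR)
  have hhalt : step P w O ρ c₂ = none := by
    rw [step_eq_none_iff] at hc₁ ⊢
    rw [hpc, hc₁]
  have hout₂ : readOut c₂.mem = out := by
    have h0 : c₂.mem 0 = c₁.mem 0 := hmem 0 (hagree 0 fun i hi => absurd hi (by omega))
    have hlen₀ : c₁.mem 0 = out.length := by rw [← hout, readOut_length]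
    rw [← hout]
    unfold readOut
    rw [h0]
    refine readSeg_congr fun j hj => hmem (1 + j) (hagree (1 + j) fun i hi hne => ?_)
    have hij : i = j := by omega
    subst hij
    exact absurd (hdiff i hne).2 (by omega)
  rw [← hout₂]
  exact outputsWithin_of_run hc₂ hhalt e.steps_le_m

end Literature.Computability.Cryptography.WordRAM
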